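/-
Origin: expansion seat `planner-pub-hodgecm-mc-axioms-1-g14-0`, handover #W237 2026-08-20T15:53:55Z md5 f816b3967916 (PKG b00c8de6cd75 → f816b3967916; 370 l.; MECHANICAL (iib-R) rewrite v3.1 of the PKG file as it stands (160 token edits; rules R1x1+R2x2+RX[h₂]x157)) (`HOME/mc/pub-hodgecm-mc-axioms-1-g14/revendor/kit-r55/stage55/HodgeCM/Model/Binders/Real34Meet.lean`, md5 f816b3967916, 370 lines);
landed by the gen-22 packager (p-g22) in gate run 55 REPLACES the earlier landed copy of `HodgeCM/Model/Binders/Real34Meet.lean` (seat copy carried the packager Origin header of an earlier run (stripped)).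
-/
/-
Origin: speedrun cell pub-hodgecm, MODEL-CONSTRUCTION sub-cell, unit pub-hodgecm-mc-binder-1-g7 (BINDER PROVER, gen 7; node
B2-meet, BINDER-OWNERS row 15 `real34`, clause `meet` of `Real34FunBridge`), seat prover-pub-hodgecm-mc-binder-1-g7-0, 2026-08-19.
(W1) REVISION ⁗ (RUN 37): tokens `levelOf (Level.isCongruenceSubgroup_coe Γ)` ↦ `Γ.K`, `isOpen_levelOf _` ↦ `Γ.isOpen_K`, `isCompact_levelOf _` ↦ `Γ.isCompact_K`, `(arithmeticLevel_levelOf _).le` ↦ `Γ.arithmeticLevel_K.le`; + (E3) `metLevel` / `hlev_holds` (the met level as a pair). Imports the ⁗ of #13 (mc-discharge-1 courtesy dae6a176542e).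
Target in PKG: HodgeCM/Model/Binders/Real34Meet.lean (NEW additive leaf; imports this kit's row #13 `Model/Binders/Real34MeetProj`
(‴ world) only; nothing landed imports it).  r2 (same day): the cross-level half is ONE named hypothesis (L-loc) of the meeting-lemma
lane — r1 routed it through `EmbCoverAt`, which is HAZARD C1 (false for the adelic embedding), RED-FLAGGED by model1 16:07:03Z.
KERNEL ONLY: 0 records, nothing cited, MODEL-N ±0; one Set-valued definition (`wset34`); junction HYPOTHESES named for their lanes:
`hι` (D-1′), `hloc` ((L-loc), meeting-lemma lane), `hU₂ hU₃` (C3 for types 2, 3), universe fact `hpc`.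
r3 (binder-1-g8, 2026-08-19, APPEND-ONLY over r2 76e3c1b245cc: r2's declarations `wset34` / `meet_of_localisation` are kept byte-identical for
their importer `Model/Binders/Real34GenMem` (mc-discharge-1 D-6); ADDED: `import …Real34Meeting` (kit #16) and §§ 3–5 = (L-loc) DECOMPOSED —
`embPieceFun`, `emb_eq_pieceEmb_embPieceFun`, the junction record `Real34Loc {Rep, sat, transl, descend}` with `Real34Loc.wset`, and
`Real34Loc.meet` (meeting step PROVED in #16 ⊕ (J-cov′) ⊕ (E3) ⊕ record ⊕ #13).  TYPING FINDING (binder-1-g8 STATUS 17:07:05Z, model1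
BINDER-TRIAGE §66): r2's (L-loc) hypothesis `hloc` over `wset34` (ARBITRARY saturated representatives) is not dischargeable; the live route is
`Real34Loc.meet` over `Real34Loc.wset` (ADMISSIBLE theta representatives).
-/
import Summits.HodgeConjecture.HodgeCM.Model.Binders.Real34MeetProj
import Summits.HodgeConjecture.HodgeCM.Model.Binders.Real34Meeting_2

/-!
# Row `real34`: the `meet` clause of `Real34FunBridge` from piece unfolding + LOCALISATION

`Real34FunBridge.meet` (PKG `Model/Binders/MeetBridges`): a (12)-wedge `Λ_{Γ₁}(ω₁, ω₂)` of `U_Ψ`-classes that pairs non-trivially with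
a global (34)-wedge-function `P ∈ wset` pairs non-trivially, at SOME level, with a (34)-wedge of `U_Ψ`-classes.  With

  `wset34 := {realise (G₃ ∧ G₄) | Γ', cl₃ ∈ Θ₂(Γ'), cl₄ ∈ Θ₃(Γ') (1,0)-classes with SATURATED representatives G₃, G₄}`

(the data `exists_rep_of_saturated` of this kit's `Gen12RepOfSat` delivers for every theta one-form) the clause splits into
* (L-loc) LOCALISATION — the cross-level half, owned by the MEETING-LEMMA lane (autform-2 tree `LevelOrbitMeeting`: sub-piece
  localisation, `pieceLiftLp_eq_sum_translate`, substitution `g = hk`; binder-1 fallback): a non-trivial pairing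
  `⟪Λ_{Γ₁}(ω₁, ω₂), realise (G₃ ∧ G₄)⟫ ≠ 0` LOCALISES to some level `Γ ≤ Γ₁` as a non-trivial pairing of the pulled-back (12)-wedge
  `Λ_Γ(cover^*ω₁, cover^*ω₂)` with the realised wedge of saturated representatives of two (34) theta one-forms AT `Γ` (the translated
  theta data of the meeting lemma).  NOT via `Fact_embCover`/`EmbCoverAt` — that binder is HAZARD C1 (false for the adelic embedding as
  soon as the cover has several components; BINDER-TRIAGE §11, model1 2026-08-19T16:07:03Z), which is why E reads `meet` in the
  level-meet shape;
* the PROJECTION at the met level — row #13 `inner_Λ_ne_zero_of_inner_realise_ne_zero` — plus `pullC_mem_Uiso` (`Fact_pull_comp`) and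
  C3 (`Θ_k(Γ) ⊆ U_{Ψ_k}`, k = 2, 3).
MAIN: **`meet_of_localisation`** — the field `Real34FunBridge.meet` at `wset := wset34`, VERBATIM, from (L-loc) + `hι` + `Fact_pull_comp` +
C3.  Nothing here is a claim of the manuscripts under adjudication.
-/

set_option autoImplicit false

noncomputable section

open scoped InnerProductSpace Matrix
open MeasureTheory MulAction Literature.MeasureTheory.Group
open Literature.NumberTheory.Automorphic Literature.NumberTheory.Automorphic.UnitaryGroup
open Literature.NumberTheory.Automorphic.LevelOrbit
open Literature.Geometry.ComplexHyperbolic.BallModel (U21 Ball x₀ Jac)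
open Literature.AlgebraicGeometry.ShimuraVarieties
open NumberField

namespace HodgeCM

namespace Model

open Literature.AlgebraicGeometry.HodgeTheory
open Literature.NumberTheory.Automorphic.PicardCM
open Literature.NumberTheory.Transcendental (Arapura2012_Cor_15_4_6)

variable (hHD : exists_isReal_hodgeModel) (hI : hodgePQ_independent_of_hodgeModel)
  (h₁ : BallQuotientUniformised)  (h₃ : CMAbelianVarietyRealised)
variable (h : Bool) (hA : Arapura2012_Cor_15_4_6)
  (W : ∀ {L : CMField} {ι₁ : L →+* ℂ} (V : HermSpace3 L ι₁) (c : SeesawCtx L), WmInput V c.D)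
  (S : ∀ {L : CMField} {ι₁ : L →+* ℂ} (V : HermSpace3 L ι₁) (c : SeesawCtx L), ThetaAdelicSide V c)
  (μ : ∀ {L : CMField}, SeesawCtx L → Fin 4 → InfinitePlace L → ℤ)

variable {L : CMField} {ι₁ : L →+* ℂ} (V : HermSpace3 L ι₁) (c : SeesawCtx L) (hV : IsAnisotropic L V.Hm)

/-! ## 1. The global (34)-wedge-functions of the pin -/

/-- **`wset34`** — the realised global wedge-functions `realise (G₃ ∧ G₄)` of SATURATED adelic representatives `G₃, G₄` of (1,0)-classes
`cl₃ ∈ Θ₂(Γ')`, `cl₄ ∈ Θ₃(Γ')`, over all levels `Γ'` (the `wset` of the (34) function bridge; `Gen12RepOfSat.exists_rep_of_saturated`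
produces such representatives for every theta one-form). -/
def wset34 : Set ((pinT hHD hI h₁ h₃ h hA W S μ).HG L ι₁ V) :=
  {P | ∃ (Γ' : Level V) (cl₃ cl₄ : ((pinX hHD hI h₁ h₃ S V c hV).D Γ').H10) (G₃ G₄ : (quotU V).leftInvCont₂),
    (cl₃ : (picardCMUniverse hHD hI h₁ h₃).CohC ((picardCMUniverse hHD hI h₁ h₃).pms L ι₁ V Γ') 1) ∈ (pinT hHD hI h₁ h₃ h hA W S μ).Theta V c 2 Γ' ∧
    (cl₄ : (picardCMUniverse hHD hI h₁ h₃).CohC ((picardCMUniverse hHD hI h₁ h₃).pms L ι₁ V Γ') 1) ∈ (pinT hHD hI h₁ h₃ h hA W S μ).Theta V c 3 Γ' ∧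
    SatLevel V hV Γ' G₃ ∧ SatLevel V hV Γ' G₄ ∧
    ((((pinX hHD hI h₁ h₃ S V c hV).D Γ').pull cl₃).1 : (pinX hHD hI h₁ h₃ S V c hV).G₁ → (Fin 2 → ℂ)) = (G₃ : (quotU V).G → (Fin 2 → ℂ)) ∘ ((pinX hHD hI h₁ h₃ S V c hV).ιinf Γ') ∧
    ((((pinX hHD hI h₁ h₃ S V c hV).D Γ').pull cl₄).1 : (pinX hHD hI h₁ h₃ S V c hV).G₁ → (Fin 2 → ℂ)) = (G₄ : (quotU V).G → (Fin 2 → ℂ)) ∘ ((pinX hHD hI h₁ h₃ S V c hV).ιinf Γ') ∧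
    P = (quotU V).realise ((quotU V).wedge₂ G₃ G₄)}

/-! ## 2. `meet` from localisation and the projection at the met level -/

/-- **`Real34FunBridge.meet` at `wset := wset34`, VERBATIM**, from: (L-loc) `hloc` — a non-trivial pairing of `Λ_{Γ₁}(ω₁, ω₂)` with
`realise (G₃ ∧ G₄) ∈ wset34` LOCALISES to a level `Γ ≤ Γ₁` as a non-trivial pairing of `Λ_Γ(cover^*ω₁, cover^*ω₂)` with the realised wedge
of SATURATED representatives `G₃', G₄'` of (1,0)-classes `cl₃' ∈ Θ₂(Γ)`, `cl₄' ∈ Θ₃(Γ)` (the meeting lemma's translated theta data);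
`hι` (D-1′'s frame junction); `Fact_pull_comp`; C3 for types `2, 3`.  Then row #13 projects at `Γ`. -/
theorem meet_of_localisation
    (hι : ∀ u : U21, (S V c).ιinf u =
      Adelic.regimeEquiv L V.Hm hV (archSectionU21CM (L : Type) ι₁ V.Hm V.sylvesterFrame (sylvesterFrame_J V) u))
    (hpc : (picardCMUniverse hHD hI h₁ h₃).Fact_pull_comp)
    (hloc : ∀ (Γ₁ : Level V) (ω₁ ω₂ : (picardCMUniverse hHD hI h₁ h₃).CohC ((picardCMUniverse hHD hI h₁ h₃).pms L ι₁ V Γ₁) 1),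
      ω₁ ∈ (picardCMUniverse hHD hI h₁ h₃).Uiso Γ₁ c.K (c.Ψ 0) c.σ → ω₂ ∈ (picardCMUniverse hHD hI h₁ h₃).Uiso Γ₁ c.K (c.Ψ 1) c.σ →
      ∀ P ∈ wset34 hHD hI h₁ h₃ h hA W S μ V c hV, ⟪(pinT hHD hI h₁ h₃ h hA W S μ).Λ Γ₁ ω₁ ω₂, P⟫_ℂ ≠ 0 →
      ∃ (Γ : Level V) (hle : Γ.Γ ≤ Γ₁.Γ) (cl₃ cl₄ : ((pinX hHD hI h₁ h₃ S V c hV).D Γ).H10) (G₃ G₄ : (quotU V).leftInvCont₂),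
        (cl₃ : (picardCMUniverse hHD hI h₁ h₃).CohC ((picardCMUniverse hHD hI h₁ h₃).pms L ι₁ V Γ) 1) ∈ (pinT hHD hI h₁ h₃ h hA W S μ).Theta V c 2 Γ ∧
        (cl₄ : (picardCMUniverse hHD hI h₁ h₃).CohC ((picardCMUniverse hHD hI h₁ h₃).pms L ι₁ V Γ) 1) ∈ (pinT hHD hI h₁ h₃ h hA W S μ).Theta V c 3 Γ ∧
        SatLevel V hV Γ G₃ ∧ SatLevel V hV Γ G₄ ∧
        ((((pinX hHD hI h₁ h₃ S V c hV).D Γ).pull cl₃).1 : (pinX hHD hI h₁ h₃ S V c hV).G₁ → (Fin 2 → ℂ)) = (G₃ : (quotU V).G → (Fin 2 → ℂ)) ∘ ((pinX hHD hI h₁ h₃ S V c hV).ιinf Γ) ∧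
        ((((pinX hHD hI h₁ h₃ S V c hV).D Γ).pull cl₄).1 : (pinX hHD hI h₁ h₃ S V c hV).G₁ → (Fin 2 → ℂ)) = (G₄ : (quotU V).G → (Fin 2 → ℂ)) ∘ ((pinX hHD hI h₁ h₃ S V c hV).ιinf Γ) ∧
        ⟪(pinT hHD hI h₁ h₃ h hA W S μ).Λ Γ ((picardCMUniverse hHD hI h₁ h₃).pullC ((pinT hHD hI h₁ h₃ h hA W S μ).cover Γ₁ Γ hle) 1 ω₁) ((picardCMUniverse hHD hI h₁ h₃).pullC ((pinT hHD hI h₁ h₃ h hA W S μ).cover Γ₁ Γ hle) 1 ω₂),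
          (quotU V).realise ((quotU V).wedge₂ G₃ G₄)⟫_ℂ ≠ 0)
    (hU₂ : ∀ Γ : Level V, (pinT hHD hI h₁ h₃ h hA W S μ).Theta V c 2 Γ ⊆ (picardCMUniverse hHD hI h₁ h₃).Uiso Γ c.K (c.Ψ 2) c.σ)
    (hU₃ : ∀ Γ : Level V, (pinT hHD hI h₁ h₃ h hA W S μ).Theta V c 3 Γ ⊆ (picardCMUniverse hHD hI h₁ h₃).Uiso Γ c.K (c.Ψ 3) c.σ) :
    ∀ (Γ₁ : Level V) (ω₁ ω₂ : (picardCMUniverse hHD hI h₁ h₃).CohC ((picardCMUniverse hHD hI h₁ h₃).pms L ι₁ V Γ₁) 1),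
      ω₁ ∈ (picardCMUniverse hHD hI h₁ h₃).Uiso Γ₁ c.K (c.Ψ 0) c.σ → ω₂ ∈ (picardCMUniverse hHD hI h₁ h₃).Uiso Γ₁ c.K (c.Ψ 1) c.σ →
      ∀ P ∈ wset34 hHD hI h₁ h₃ h hA W S μ V c hV, ⟪(pinT hHD hI h₁ h₃ h hA W S μ).Λ Γ₁ ω₁ ω₂, P⟫_ℂ ≠ 0 →
      ∃ (Γ : Level V) (ω : Fin 4 → (picardCMUniverse hHD hI h₁ h₃).CohC ((picardCMUniverse hHD hI h₁ h₃).pms L ι₁ V Γ) 1),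
        (∀ i, ω i ∈ (picardCMUniverse hHD hI h₁ h₃).Uiso Γ c.K (c.Ψ i) c.σ) ∧ ⟪(pinT hHD hI h₁ h₃ h hA W S μ).Λ Γ (ω 2) (ω 3), (pinT hHD hI h₁ h₃ h hA W S μ).Λ Γ (ω 0) (ω 1)⟫_ℂ ≠ 0 := by
  intro Γ₁ ω₁ ω₂ e₁ e₂ P hP hne
  obtain ⟨Γ, hle, cl₃, cl₄, G₃, G₄, hΘ₃, hΘ₄, hS₃, hS₄, hp₃, hp₄, hne'⟩ := hloc Γ₁ ω₁ ω₂ e₁ e₂ P hP hne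
  -- the pulled-back (12)-classes are `U_Ψ`-classes
  set η₁ := (picardCMUniverse hHD hI h₁ h₃).pullC ((pinT hHD hI h₁ h₃ h hA W S μ).cover Γ₁ Γ hle) 1 ω₁ with hη₁
  set η₂ := (picardCMUniverse hHD hI h₁ h₃).pullC ((pinT hHD hI h₁ h₃ h hA W S μ).cover Γ₁ Γ hle) 1 ω₂ with hη₂
  have e₁' : η₁ ∈ (picardCMUniverse hHD hI h₁ h₃).Uiso Γ c.K (c.Ψ 0) c.σ := (picardCMUniverse hHD hI h₁ h₃).pullC_mem_Uiso hpc ((pinT hHD hI h₁ h₃ h hA W S μ).cover Γ₁ Γ hle) c.K (c.Ψ 0) c.σ e₁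
  have e₂' : η₂ ∈ (picardCMUniverse hHD hI h₁ h₃).Uiso Γ c.K (c.Ψ 1) c.σ := (picardCMUniverse hHD hI h₁ h₃).pullC_mem_Uiso hpc ((pinT hHD hI h₁ h₃ h hA W S μ).cover Γ₁ Γ hle) c.K (c.Ψ 1) c.σ e₂
  -- the projection at the met level (row #13)
  have hmeet := inner_Λ_ne_zero_of_inner_realise_ne_zero hHD hI h₁ h₃ h hA W S μ V c hV hι Γ η₁ η₂ cl₃ cl₄ G₃ G₄
    hS₃ hS₄ hp₃ hp₄ hne'
  refine ⟨Γ, ![η₁, η₂, (cl₃ : (picardCMUniverse hHD hI h₁ h₃).CohC ((picardCMUniverse hHD hI h₁ h₃).pms L ι₁ V Γ) 1), (cl₄ : (picardCMUniverse hHD hI h₁ h₃).CohC ((picardCMUniverse hHD hI h₁ h₃).pms L ι₁ V Γ) 1)], ?_, ?_⟩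
  · intro i
    fin_cases i
    · exact e₁'
    · exact e₂'
    · exact hU₂ Γ hΘ₃
    · exact hU₃ Γ hΘ₄
  · exact hmeet

/-!
## r3: (L-loc) decomposed (binder-1-g8)

With `wset` read through a PREDICATE `Rep Γ i G` («`G` is an admissible adelic theta representative of type `i` at level `Γ`»; RUN-37 value
`G ∈ span (thetaGen Γ i adm)`, `adm = IsSaturated ∧ IsStrict` — what kit #10 `exists_rep_of_saturated` delivers) and three junctions
`sat` (J-sat), `transl` (J-τ34)(c)₁ translation stability, `descend` (J-τ34)(c)₂ CLASSMAP descent (record `Real34Loc`), the clause `meet` follows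
(`Real34Loc.meet`) from the MEETING STEP `Real34Meeting.exists_inner_pieceEmb_rTranslate₂_ne_zero` (PROVED, kit #16), glue-1's emb-lane junction
(J-cov′) `hcov` («`emb_Γ ∘ cover^*` is the pull-back of emb's principal-piece function of level `Γ₁` through the same base point»), the level
existence (E3) `hlev` («a level with compact open `K_{Γ₁} ∩ k_f⁻¹ K_{Γ'} k_f` below `Γ₁` exists»; the pair `(Γ(K), K)` of the (W1) world),
`hι`, `Fact_pull_comp` / `Fact_pull_cup`, C3₂,₃ and kit #13's projection at the met level.  The instance of the record with its fields
discharged from theta-lane exports is `Model/Binders/Real34LocOfThetaGen`.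
-/

/-! ## 3. (r3) emb's principal-piece function and `Λ` as a piece embedding -/

/-- **emb's principal-piece function** at level `Γ`: the tree lift `principalHolFormLiftCM` (at emb's datum, Hodge model, UNIFORM Sylvester
frame `embFrameOf` and finite level `K_Γ`) of the holomorphic top form `embTopForm Γ η` of the class `η` — the function `f` with
`emb_Γ η = pieceEmb_{M_{K_Γ}} f` (`emb_eq_pieceEmb_embPieceFun`; mc-discharge-1's Step 1, `EmbInstance.embOf_apply`).  A reducible name for an
existing term (no content). -/
abbrev embPieceFun (Γ : Level V) (η : (picardCMUniverse hHD hI h₁ h₃).CohC ((picardCMUniverse hHD hI h₁ h₃).pms L ι₁ V Γ) 2) :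
    C(arch (↥(maximalRealSubfield L)) L (IsCMField.complexConj L) 3 V.Hm ⧸
      pieceLattice (cmSplitLevel (L : Type) 3 V.Hm Γ.K) (adelicUnitaryRat (L : Type) V.Hm)
        (cmSplitProj (L : Type) 3 V.Hm Γ.K) (cmPrincipalPoint (L : Type) 3 V.Hm), ℂ) :=
  (embDatum h₁ h₃ Γ hV).principalHolFormLiftCM (embHodgeModel hHD h₁ h₃ Γ) (embFrameOf h₁ h₃ Γ hV) L V.Hm ι₁
    (map_Hm_eq_ballDatum_H_map (ballQuotientUniformisedDatum_of h₁) h₃ Γ ((isAnisotropic_pmsCode_iff L ι₁ V Γ).2 hV))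
    Γ.K Γ.arithmeticLevel_K.le
    (map_Γ_le_ballDatum (ballQuotientUniformisedDatum_of h₁) h₃ Γ ((isAnisotropic_pmsCode_iff L ι₁ V Γ).2 hV))
    (embTopForm hHD hI h₁ h₃ Γ η)

/-- **`emb_Γ η = pieceEmb_{M_{K_Γ}} (embPieceFun Γ η)`** (mc-discharge-1's Step 1: `embOf_apply` + `rfl`). -/
theorem emb_eq_pieceEmb_embPieceFun (Γ : Level V)
    (η : (picardCMUniverse hHD hI h₁ h₃).CohC ((picardCMUniverse hHD hI h₁ h₃).pms L ι₁ V Γ) 2) :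
    haveI := compactSpace_principalQuot V hV Γ.K Γ.isOpen_K
    (pinT hHD hI h₁ h₃ h hA W S μ).emb Γ η =
      (quotU V).pieceEmb (adelicUnitaryRat (L : Type) V.Hm) (regimeEquivT V hV) (regimeEquivT_mem_Γ_iff V hV)
        (cmSplitLevel (L : Type) 3 V.Hm Γ.K)
        (cmSplitProj (L : Type) 3 V.Hm Γ.K) (cmPrincipalPoint (L : Type) 3 V.Hm)
        (isOpen_cmSplitLevel (L : Type) 3 V.Hm _ Γ.isOpen_K) (continuous_cmSplitProj (L : Type) 3 V.Hm _)
        (embPieceFun hHD hI h₁ h₃ V hV Γ η) := by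
  change embOf hHD hI h₁ h₃ Γ η = _
  rw [embOf_apply hHD hI h₁ h₃ Γ hV]
  rfl


/-- **Currency bridge for the emb lane (glue-1 ASK 1, 17:27:14Z)**: binder-1's `pieceEmb` at the tree-typed transport `regimeEquivT` IS E's
`regimeTransportL2` of the tree's `pieceLiftLp` against `regimeν` (definitional: `pieceEmb = transportEmb ∘ pieceLiftLp`, `regimeTransportL2 =
transportL2` at `regimeEquiv`, `regimeν = pullbackν`). -/
theorem pieceEmb_eq_regimeTransportL2
    (M : Subgroup ↥(Literature.NumberTheory.Automorphic.adelicUnitaryGroup (L : Type) V.Hm))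
    {A : Type*} [Group A] [TopologicalSpace A]
    (π : M →* A)
    [CompactSpace (A ⧸ pieceLattice M (adelicUnitaryRat (L : Type) V.Hm) π (cmPrincipalPoint (L : Type) 3 V.Hm))]
    (hM : IsOpen (M : Set ↥(Literature.NumberTheory.Automorphic.adelicUnitaryGroup (L : Type) V.Hm))) (hπ : Continuous π)
    (f : C(A ⧸ pieceLattice M (adelicUnitaryRat (L : Type) V.Hm) π (cmPrincipalPoint (L : Type) 3 V.Hm), ℂ)) :
    (quotU V).pieceEmb (adelicUnitaryRat (L : Type) V.Hm) (regimeEquivT V hV) (regimeEquivT_mem_Γ_iff V hV) M π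
        (cmPrincipalPoint (L : Type) 3 V.Hm) hM hπ f =
      V.regimeTransportL2 printFact_unitaryCompact_holds hV
        (pieceLiftLp ℂ M (adelicUnitaryRat (L : Type) V.Hm) π (cmPrincipalPoint (L : Type) 3 V.Hm)
          (V.regimeν printFact_unitaryCompact_holds hV) 2 hM hπ f) :=
  rfl

/-! ## 4. (r3) The junction record: admissible adelic theta representatives of the (34) one-forms -/

/-- **The (34)-side junction record of row `real34`** (regime `hV`).  `Rep Γ i G` = «`G` is an admissible adelic theta representative of type
`i` at level `Γ`» (RUN-37 value: `G ∈ span (thetaGen Γ i adm)`); the three `Prop` fields are the junctions (J-sat), (J-τ34)(c)₁ translation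
stability, (J-τ34)(c)₂ CLASSMAP descent, each typed at the strength its producer exports.  Nothing here is asserted: the record is a
HYPOTHESIS of `Real34Loc.meet`. -/
structure Real34Loc where
  /-- admissible adelic theta representatives of type `i` at level `Γ` -/
  Rep : Level V → Fin 4 → (quotU V).leftInvCont₂ → Prop
  /-- (J-sat) representatives are saturated at the level (mc-discharge-1's `SatLevel`) -/
  sat : ∀ (Γ : Level V) (i : Fin 4) (G : (quotU V).leftInvCont₂), Rep Γ i G → SatLevel V hV Γ G
  /-- (J-τ34)(c)₁ TRANSLATION STABILITY: the right translate by the finite idele-matrix `k_f⁻¹` of a representative at `Γ'` is a representative at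
  every level `Γ` with `K_Γ ≤ k_f⁻¹ K_{Γ'} k_f` -/
  transl : ∀ (Γ' Γ : Level V) (i : Fin 4) (G : (quotU V).leftInvCont₂) (kf : (finAdelic (↥(maximalRealSubfield L)) L (IsCMField.complexConj L) 3 V.Hm)),
    Rep Γ' i G → Γ.K ≤ conjLevel Γ'.K kf⁻¹ →
    Rep Γ i ((quotU V).rTranslate₂ G (regimeEquivT V hV ((cmAdelicProdEquiv (L : Type) 3 V.Hm).symm (1, kf⁻¹))))
  /-- (J-τ34)(c)₂ CLASSMAP DESCENT: a representative at `Γ` restricts along `ιinf` to the pulled-back form of a theta class of `Θ_i(Γ)` -/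
  descend : ∀ (Γ : Level V) (i : Fin 4) (G : (quotU V).leftInvCont₂), Rep Γ i G →
    ∃ cl : ((pinX hHD hI h₁ h₃ S V c hV).D Γ).H10,
      (cl : (picardCMUniverse hHD hI h₁ h₃).CohC ((picardCMUniverse hHD hI h₁ h₃).pms L ι₁ V Γ) 1) ∈ (pinT hHD hI h₁ h₃ h hA W S μ).Theta V c i Γ ∧
      ((((pinX hHD hI h₁ h₃ S V c hV).D Γ).pull cl).1 : (pinX hHD hI h₁ h₃ S V c hV).G₁ → (Fin 2 → ℂ)) = (G : (quotU V).G → (Fin 2 → ℂ)) ∘ ((pinX hHD hI h₁ h₃ S V c hV).ιinf Γ)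

namespace Real34Loc

variable {hHD hI h₁ h₃ h hA W S μ V c hV}
variable (J : Real34Loc hHD hI h₁ h₃ h hA W S μ V c hV)

/-- **The global (34)-wedge-functions of the record**: realised global wedges `realise (G₃ ∧ G₄)` of admissible representatives of types `2, 3`
at a common level (the `wset` of the (34) function bridge; r2's `wset34` restricted to admissible representatives). -/
def wset : Set ((pinT hHD hI h₁ h₃ h hA W S μ).HG L ι₁ V) :=
  {P | ∃ (Γ' : Level V) (G₃ G₄ : (quotU V).leftInvCont₂), J.Rep Γ' 2 G₃ ∧ J.Rep Γ' 3 G₄ ∧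
    P = (quotU V).realise ((quotU V).wedge₂ G₃ G₄)}

/-- (Ported verbatim from the HodgeCMPerL package; no docstring in the source.) -/
theorem realise_wedge₂_mem_wset {Γ' : Level V} {G₃ G₄ : (quotU V).leftInvCont₂} (h₃' : J.Rep Γ' 2 G₃) (h₄' : J.Rep Γ' 3 G₄) :
    ((quotU V).realise ((quotU V).wedge₂ G₃ G₄) : (pinT hHD hI h₁ h₃ h hA W S μ).HG L ι₁ V) ∈ J.wset :=
  ⟨Γ', G₃, G₄, h₃', h₄', rfl⟩

/-! ### (E3) in the (W1) world: the met level is a PAIR, no hypothesis -/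

/-- **(E3) — the met level as an honest `Level`** (the (W1) `Level` is the pair `(Γ, K)`): for levels `Γ₁`, `Γ'` and a finite idele-matrix
`k_f`, the pair `(Γ(K₁ ∩ k_f⁻¹ K' k_f), K₁ ∩ k_f⁻¹ K' k_f)` with `K₁ = Γ₁.K`, `K' = Γ'.K` (compact: closed in the compact `K₁`; open; torsion
free as a subgroup of `Γ₁.Γ`). -/
def _root_.HodgeCM.Model.metLevel (Γ₁ Γ' : Level V) (kf : finAdelic (↥(maximalRealSubfield L)) L (IsCMField.complexConj L) 3 V.Hm) : Level V where
  Γ := UnitaryGroup.arithmeticLevel (↥(maximalRealSubfield L)) L (IsCMField.complexConj L) 3 V.Hm (Γ₁.K ⊓ conjLevel Γ'.K kf⁻¹)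
  K := Γ₁.K ⊓ conjLevel Γ'.K kf⁻¹
  isCompact_K := Γ₁.isCompact_K.inter_right ((conjLevel Γ'.K kf⁻¹).isClosed_of_isOpen (isOpen_conjLevel _ Γ'.isOpen_K _))
  isOpen_K := Γ₁.isOpen_K.inter (isOpen_conjLevel _ Γ'.isOpen_K _)
  arithmeticLevel_K := rfl
  torsionFree γ hγ hfin := Γ₁.torsionFree γ
    (Γ₁.arithmeticLevel_K ▸ UnitaryGroup.arithmeticLevel_mono
      (F := ↥(maximalRealSubfield L)) (E := L) (c := IsCMField.complexConj L) (N := 3) (J := V.Hm)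
      (inf_le_left : Γ₁.K ⊓ conjLevel Γ'.K kf⁻¹ ≤ Γ₁.K) hγ) hfin

/-- (Ported verbatim from the HodgeCMPerL package; no docstring in the source.) -/
theorem _root_.HodgeCM.Model.metLevel_le (Γ₁ Γ' : Level V) (kf : finAdelic (↥(maximalRealSubfield L)) L (IsCMField.complexConj L) 3 V.Hm) :
    HodgeCM.Model.metLevel Γ₁ Γ' kf ≤ Γ₁ :=
  (inf_le_left : Γ₁.K ⊓ conjLevel Γ'.K kf⁻¹ ≤ Γ₁.K)

/-- (Ported verbatim from the HodgeCMPerL package; no docstring in the source.) -/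
@[simp] theorem _root_.HodgeCM.Model.metLevel_K (Γ₁ Γ' : Level V) (kf : finAdelic (↥(maximalRealSubfield L)) L (IsCMField.complexConj L) 3 V.Hm) :
    (HodgeCM.Model.metLevel Γ₁ Γ' kf).K = Γ₁.K ⊓ conjLevel Γ'.K kf⁻¹ := rfl

/-- **(E3) discharged**: the level-existence hypothesis `hlev` of `Real34Loc.meet` holds in the (W1) world. -/
theorem _root_.HodgeCM.Model.hlev_holds : ∀ (Γ₁ Γ' : Level V) (kf : finAdelic (↥(maximalRealSubfield L)) L (IsCMField.complexConj L) 3 V.Hm),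
    kf ∈ Γ₁.K → ∃ Γ : Level V, Γ.Γ ≤ Γ₁.Γ ∧ Γ.K = Γ₁.K ⊓ conjLevel Γ'.K kf⁻¹ :=
  fun Γ₁ Γ' kf _ => ⟨HodgeCM.Model.metLevel Γ₁ Γ' kf, Level.Γ_mono (HodgeCM.Model.metLevel_le Γ₁ Γ' kf), rfl⟩

/-! ## 5. (r3) `meet` from the meeting step, (J-cov′), (E3) and the projection at the met level -/

/-- **`Real34FunBridge.meet` at `wset := J.wset`, VERBATIM.**  Hypotheses beyond the record `J`: `hι` (D-1′'s frame junction), the universe facts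
`Fact_pull_comp` / `Fact_pull_cup`, glue-1's (J-cov′) `hcov` — `emb_Γ (cover^* (ω₁ ∪ ω₂)) = pieceEmb_{M_{K_Γ}, π_{K_{Γ₁}}|, [1]} ((embPieceFun Γ₁ (ω₁ ∪ ω₂)) ∘ levelCover)`
for `Γ.Γ ≤ Γ₁.Γ`, `K_Γ ≤ K_{Γ₁}` and (1,0)-classes `ω₁, ω₂ ∈ H10(P_{Γ₁})` (the RESTRICTED junction of record, model1 (J-cov′-geom) 17:28:43Z:
(A) glue-1 `Junction/EmbLevelCover` ∘ (B′) period-1 degree-one ball naturality), plus the universe fact `Fact_pull_hodge` (`Uiso ≤ H10`) —, the level existence (E3) `hlev` — for `k_f ∈ K_{Γ₁}` some level `Γ` below `Γ₁` has compact open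
`K_Γ = K_{Γ₁} ∩ k_f⁻¹ K_{Γ'} k_f` (the pair `(Γ(K), K)` of the (W1) world) —, and C3 for types `2, 3`.  Proof: `Λ_{Γ₁}(ω₁,ω₂) = pieceEmb_{M_{K_{Γ₁}}} f`
(`emb_eq_pieceEmb_embPieceFun`) ⟶ MEETING STEP (kit #16) ⟶ level `Γ` of (E3) ⟶ (J-cov′) + `Λ_pullC_cover` read the localised class as
`Λ_Γ(cover^*ω₁, cover^*ω₂)` ⟶ `transl`/`sat`/`descend` make the translated representatives admissible, saturated, theta at `Γ` ⟶ kit #13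
projects at `Γ`. -/
theorem meet
    (hι : ∀ u : U21, (S V c).ιinf u =
      Adelic.regimeEquiv L V.Hm hV (archSectionU21CM (L : Type) ι₁ V.Hm V.sylvesterFrame (sylvesterFrame_J V) u))
    (hpc : (picardCMUniverse hHD hI h₁ h₃).Fact_pull_comp) (hcup : (picardCMUniverse hHD hI h₁ h₃).Fact_pull_cup) (hph : (picardCMUniverse hHD hI h₁ h₃).Fact_pull_hodge)
    (hcov : ∀ (Γ₁ Γ : Level V) (hle : Γ.Γ ≤ Γ₁.Γ) (hK : Γ.K ≤ Γ₁.K)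
        (ω₁ ω₂ : (picardCMUniverse hHD hI h₁ h₃).CohC ((picardCMUniverse hHD hI h₁ h₃).pms L ι₁ V Γ₁) 1),
      ω₁ ∈ (picardCMUniverse hHD hI h₁ h₃).H10 ((picardCMUniverse hHD hI h₁ h₃).pms L ι₁ V Γ₁) → ω₂ ∈ (picardCMUniverse hHD hI h₁ h₃).H10 ((picardCMUniverse hHD hI h₁ h₃).pms L ι₁ V Γ₁) →
      haveI := compactSpace_subQuot V hV Γ₁.K Γ.K hK Γ.isOpen_K
      (pinT hHD hI h₁ h₃ h hA W S μ).emb Γ ((picardCMUniverse hHD hI h₁ h₃).pullC ((pinT hHD hI h₁ h₃ h hA W S μ).cover Γ₁ Γ hle) (1 + 1)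
        ((picardCMUniverse hHD hI h₁ h₃).cup2C ((picardCMUniverse hHD hI h₁ h₃).pms L ι₁ V Γ₁) 1 ω₁ ω₂)) =
        (quotU V).pieceEmb (adelicUnitaryRat (L : Type) V.Hm) (regimeEquivT V hV) (regimeEquivT_mem_Γ_iff V hV)
          (cmSplitLevel (L : Type) 3 V.Hm Γ.K)
          ((cmSplitProj (L : Type) 3 V.Hm Γ₁.K).comp (Subgroup.inclusion (splitLevel_mono (cmAdelicProdEquiv (L : Type) 3 V.Hm).toMulEquiv hK)))
          (cmPrincipalPoint (L : Type) 3 V.Hm)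
          (isOpen_cmSplitLevel (L : Type) 3 V.Hm Γ.K Γ.isOpen_K)
          ((continuous_cmSplitProj (L : Type) 3 V.Hm Γ₁.K).comp (continuous_inclusion (splitLevel_mono (cmAdelicProdEquiv (L : Type) 3 V.Hm).toMulEquiv hK)))
          ((embPieceFun hHD hI h₁ h₃ V hV Γ₁ ((picardCMUniverse hHD hI h₁ h₃).cup2C ((picardCMUniverse hHD hI h₁ h₃).pms L ι₁ V Γ₁) 1 ω₁ ω₂)).comp
            (levelCoverCM (cmSplitLevel (L : Type) 3 V.Hm Γ₁.K) (adelicUnitaryRat (L : Type) V.Hm) (cmSplitProj (L : Type) 3 V.Hm Γ₁.K)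
              (cmPrincipalPoint (L : Type) 3 V.Hm) (cmSplitLevel (L : Type) 3 V.Hm Γ.K) (splitLevel_mono (cmAdelicProdEquiv (L : Type) 3 V.Hm).toMulEquiv hK))))
    (hlev : ∀ (Γ₁ Γ' : Level V) (kf : (finAdelic (↥(maximalRealSubfield L)) L (IsCMField.complexConj L) 3 V.Hm)), kf ∈ Γ₁.K →
      ∃ Γ : Level V, Γ.Γ ≤ Γ₁.Γ ∧ Γ.K = Γ₁.K ⊓ conjLevel Γ'.K kf⁻¹)
    (hU₂ : ∀ Γ : Level V, (pinT hHD hI h₁ h₃ h hA W S μ).Theta V c 2 Γ ⊆ (picardCMUniverse hHD hI h₁ h₃).Uiso Γ c.K (c.Ψ 2) c.σ)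
    (hU₃ : ∀ Γ : Level V, (pinT hHD hI h₁ h₃ h hA W S μ).Theta V c 3 Γ ⊆ (picardCMUniverse hHD hI h₁ h₃).Uiso Γ c.K (c.Ψ 3) c.σ) :
    ∀ (Γ₁ : Level V) (ω₁ ω₂ : (picardCMUniverse hHD hI h₁ h₃).CohC ((picardCMUniverse hHD hI h₁ h₃).pms L ι₁ V Γ₁) 1),
      ω₁ ∈ (picardCMUniverse hHD hI h₁ h₃).Uiso Γ₁ c.K (c.Ψ 0) c.σ → ω₂ ∈ (picardCMUniverse hHD hI h₁ h₃).Uiso Γ₁ c.K (c.Ψ 1) c.σ →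
      ∀ P ∈ J.wset, ⟪(pinT hHD hI h₁ h₃ h hA W S μ).Λ Γ₁ ω₁ ω₂, P⟫_ℂ ≠ 0 →
      ∃ (Γ : Level V) (ω : Fin 4 → (picardCMUniverse hHD hI h₁ h₃).CohC ((picardCMUniverse hHD hI h₁ h₃).pms L ι₁ V Γ) 1),
        (∀ i, ω i ∈ (picardCMUniverse hHD hI h₁ h₃).Uiso Γ c.K (c.Ψ i) c.σ) ∧ ⟪(pinT hHD hI h₁ h₃ h hA W S μ).Λ Γ (ω 2) (ω 3), (pinT hHD hI h₁ h₃ h hA W S μ).Λ Γ (ω 0) (ω 1)⟫_ℂ ≠ 0 := by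
  intro Γ₁ ω₁ ω₂ e₁ e₂ P hP hne
  obtain ⟨Γ', G₃, G₄, hR₃, hR₄, rfl⟩ := hP
  /- ### Step 1: `Λ_{Γ₁}(ω₁, ω₂)` is the piece embedding of emb's principal-piece function -/
  haveI i₁ := compactSpace_principalQuot V hV Γ₁.K Γ₁.isOpen_K
  have hΛ := emb_eq_pieceEmb_embPieceFun hHD hI h₁ h₃ h hA W S μ V hV Γ₁ ((picardCMUniverse hHD hI h₁ h₃).cup2C ((picardCMUniverse hHD hI h₁ h₃).pms L ι₁ V Γ₁) 1 ω₁ ω₂)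
  rw [Universe.ThetaModel.Λ_apply, hΛ] at hne
  /- ### Step 2: the meeting step (kit #16) at `K₁ := K_{Γ₁}`, `K' := K_{Γ'}` -/
  haveI i₂ : ∀ k : ↥Γ₁.K, CompactSpace (arch (↥(maximalRealSubfield L)) L (IsCMField.complexConj L) 3 V.Hm ⧸
      pieceLattice (cmSplitLevel (L : Type) 3 V.Hm (Γ₁.K ⊓ conjLevel Γ'.K (k : (finAdelic (↥(maximalRealSubfield L)) L (IsCMField.complexConj L) 3 V.Hm))⁻¹)) (adelicUnitaryRat (L : Type) V.Hm)
        ((cmSplitProj (L : Type) 3 V.Hm Γ₁.K).comp (Subgroup.inclusion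
          (splitLevel_mono (cmAdelicProdEquiv (L : Type) 3 V.Hm).toMulEquiv (inf_le_left : Γ₁.K ⊓ conjLevel Γ'.K (k : (finAdelic (↥(maximalRealSubfield L)) L (IsCMField.complexConj L) 3 V.Hm))⁻¹ ≤ Γ₁.K))))
        (cmPrincipalPoint (L : Type) 3 V.Hm)) :=
    fun k => compactSpace_subQuot V hV _ _ inf_le_left
      (isOpen_coe_subgroup_inf Γ₁.isOpen_K (isOpen_conjLevel _ Γ'.isOpen_K _))
  obtain ⟨⟨kf, hkf⟩, hpair, -, -⟩ := exists_inner_pieceEmb_rTranslate₂_ne_zero V hV Γ₁.K Γ'.K Γ₁.isCompact_K Γ₁.isOpen_K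
    Γ'.isOpen_K (embPieceFun hHD hI h₁ h₃ V hV Γ₁ ((picardCMUniverse hHD hI h₁ h₃).cup2C ((picardCMUniverse hHD hI h₁ h₃).pms L ι₁ V Γ₁) 1 ω₁ ω₂)) G₃ G₄
    (sat_comp_regimeEquiv_of_sat V hV _ G₃ (fun g m hm => J.sat Γ' 2 G₃ hR₃ g m hm))
    (sat_comp_regimeEquiv_of_sat V hV _ G₄ (fun g m hm => J.sat Γ' 3 G₄ hR₄ g m hm)) hne
  /- ### Step 3: the met level (E3) and the localised pairing read through (J-cov′) -/
  obtain ⟨Γ, hle, hKΓ⟩ := hlev Γ₁ Γ' kf hkf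
  have hK : Γ.K ≤ Γ₁.K := by rw [hKΓ]; exact inf_le_left
  have hK' : Γ.K ≤ conjLevel Γ'.K kf⁻¹ := by rw [hKΓ]; exact inf_le_right
  have aux : ∀ (K'' : Subgroup (finAdelic (↥(maximalRealSubfield L)) L (IsCMField.complexConj L) 3 V.Hm)) (hK'' : K'' ≤ Γ₁.K) (hK''o : IsOpen (K'' : Set (finAdelic (↥(maximalRealSubfield L)) L (IsCMField.complexConj L) 3 V.Hm))), K'' = Γ₁.K ⊓ conjLevel Γ'.K kf⁻¹ →
      haveI := compactSpace_subQuot V hV Γ₁.K K'' hK'' hK''o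
      ⟪(quotU V).pieceEmb (adelicUnitaryRat (L : Type) V.Hm) (regimeEquivT V hV) (regimeEquivT_mem_Γ_iff V hV)
          (cmSplitLevel (L : Type) 3 V.Hm K'')
          ((cmSplitProj (L : Type) 3 V.Hm Γ₁.K).comp (Subgroup.inclusion (splitLevel_mono (cmAdelicProdEquiv (L : Type) 3 V.Hm).toMulEquiv hK'')))
          (cmPrincipalPoint (L : Type) 3 V.Hm)
          (isOpen_cmSplitLevel (L : Type) 3 V.Hm K'' hK''o)
          ((continuous_cmSplitProj (L : Type) 3 V.Hm Γ₁.K).comp (continuous_inclusion (splitLevel_mono (cmAdelicProdEquiv (L : Type) 3 V.Hm).toMulEquiv hK'')))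
          ((embPieceFun hHD hI h₁ h₃ V hV Γ₁ ((picardCMUniverse hHD hI h₁ h₃).cup2C ((picardCMUniverse hHD hI h₁ h₃).pms L ι₁ V Γ₁) 1 ω₁ ω₂)).comp
            (levelCoverCM (cmSplitLevel (L : Type) 3 V.Hm Γ₁.K) (adelicUnitaryRat (L : Type) V.Hm) (cmSplitProj (L : Type) 3 V.Hm Γ₁.K)
              (cmPrincipalPoint (L : Type) 3 V.Hm) (cmSplitLevel (L : Type) 3 V.Hm K'') (splitLevel_mono (cmAdelicProdEquiv (L : Type) 3 V.Hm).toMulEquiv hK''))),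
        (quotU V).realise ((quotU V).wedge₂
          ((quotU V).rTranslate₂ G₃ (regimeEquivT V hV ((cmAdelicProdEquiv (L : Type) 3 V.Hm).symm (1, kf⁻¹))))
          ((quotU V).rTranslate₂ G₄ (regimeEquivT V hV ((cmAdelicProdEquiv (L : Type) 3 V.Hm).symm (1, kf⁻¹)))))⟫_ℂ ≠ 0 := by
    rintro K'' hK'' hK''o rfl
    exact hpair
  have hmain := aux Γ.K hK Γ.isOpen_K hKΓ
  have hloc : ⟪(pinT hHD hI h₁ h₃ h hA W S μ).Λ Γ ((picardCMUniverse hHD hI h₁ h₃).pullC ((pinT hHD hI h₁ h₃ h hA W S μ).cover Γ₁ Γ hle) 1 ω₁) ((picardCMUniverse hHD hI h₁ h₃).pullC ((pinT hHD hI h₁ h₃ h hA W S μ).cover Γ₁ Γ hle) 1 ω₂),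
      (quotU V).realise ((quotU V).wedge₂
        ((quotU V).rTranslate₂ G₃ (regimeEquivT V hV ((cmAdelicProdEquiv (L : Type) 3 V.Hm).symm (1, kf⁻¹))))
        ((quotU V).rTranslate₂ G₄ (regimeEquivT V hV ((cmAdelicProdEquiv (L : Type) 3 V.Hm).symm (1, kf⁻¹)))))⟫_ℂ ≠ 0 := by
    rw [(pinT hHD hI h₁ h₃ h hA W S μ).Λ_pullC_cover hcup Γ₁ Γ hle ω₁ ω₂,
      hcov Γ₁ Γ hle hK ω₁ ω₂ ((picardCMUniverse hHD hI h₁ h₃).Uiso_le_H10 hph Γ₁ c.K (c.Ψ 0) c.σ e₁)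
        ((picardCMUniverse hHD hI h₁ h₃).Uiso_le_H10 hph Γ₁ c.K (c.Ψ 1) c.σ e₂)]
    exact hmain
  /- ### Step 4: the translated representatives are admissible, saturated and theta at `Γ`; project (kit #13) -/
  have hR₃' := J.transl Γ' Γ 2 G₃ kf hR₃ hK'
  have hR₄' := J.transl Γ' Γ 3 G₄ kf hR₄ hK'
  obtain ⟨cl₃, hΘ₃, hp₃⟩ := J.descend Γ 2 _ hR₃'
  obtain ⟨cl₄, hΘ₄, hp₄⟩ := J.descend Γ 3 _ hR₄'
  have hmeet := inner_Λ_ne_zero_of_inner_realise_ne_zero hHD hI h₁ h₃ h hA W S μ V c hV hι Γ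
    ((picardCMUniverse hHD hI h₁ h₃).pullC ((pinT hHD hI h₁ h₃ h hA W S μ).cover Γ₁ Γ hle) 1 ω₁) ((picardCMUniverse hHD hI h₁ h₃).pullC ((pinT hHD hI h₁ h₃ h hA W S μ).cover Γ₁ Γ hle) 1 ω₂) cl₃ cl₄ _ _
    (J.sat Γ 2 _ hR₃') (J.sat Γ 3 _ hR₄') hp₃ hp₄ hloc
  refine ⟨Γ, ![(picardCMUniverse hHD hI h₁ h₃).pullC ((pinT hHD hI h₁ h₃ h hA W S μ).cover Γ₁ Γ hle) 1 ω₁, (picardCMUniverse hHD hI h₁ h₃).pullC ((pinT hHD hI h₁ h₃ h hA W S μ).cover Γ₁ Γ hle) 1 ω₂,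
    (cl₃ : (picardCMUniverse hHD hI h₁ h₃).CohC ((picardCMUniverse hHD hI h₁ h₃).pms L ι₁ V Γ) 1), (cl₄ : (picardCMUniverse hHD hI h₁ h₃).CohC ((picardCMUniverse hHD hI h₁ h₃).pms L ι₁ V Γ) 1)], ?_, hmeet⟩
  intro i
  fin_cases i
  · exact (picardCMUniverse hHD hI h₁ h₃).pullC_mem_Uiso hpc ((pinT hHD hI h₁ h₃ h hA W S μ).cover Γ₁ Γ hle) c.K (c.Ψ 0) c.σ e₁
  · exact (picardCMUniverse hHD hI h₁ h₃).pullC_mem_Uiso hpc ((pinT hHD hI h₁ h₃ h hA W S μ).cover Γ₁ Γ hle) c.K (c.Ψ 1) c.σ e₂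
  · exact hU₂ Γ hΘ₃
  · exact hU₃ Γ hΘ₄

end Real34Loc

end Model

end HodgeCM

end
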